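import Mathlib
import Summits.ValiantsHypothesis.ValiantsHypothesis.Theorems.NewtonTauWeak.Negative.Zonogon
import Summits.ValiantsHypothesis.ValiantsHypothesis.Theorems.NewtonUnitEquationsNewtonTauWeakSeparatedRank
import Summits.ValiantsHypothesis.ValiantsHypothesis.Theorems.NewtonUnitEquationsNewtonTauWeakVdpDefs
import Summits.ValiantsHypothesis.ValiantsHypothesis.Theorems.NewtonUnitEquationsNewtonTauWeakStubVertexCharts
import Summits.ValiantsHypothesis.ValiantsHypothesis.Theorems.NewtonUnitEquationsNewtonTauWeakStubChartPairCount
import Summits.ValiantsHypothesis.ValiantsHypothesis.Theorems.NewtonUnitEquationsNewtonTauWeakStubProductVertices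
import Summits.ValiantsHypothesis.ValiantsHypothesis.Theorems.NewtonUnitEquationsNewtonTauWeakHexagonDelta
import Summits.ValiantsHypothesis.ValiantsHypothesis.Theorems.NewtonUnitEquationsNewtonTauWeakHexagonSeparated
import Summits.ValiantsHypothesis.ValiantsHypothesis.Theorems.NewtonUnitEquationsNewtonTauWeakHexagonVertexTools
import Summits.ValiantsHypothesis.ValiantsHypothesis.Theorems.NewtonUnitEquationsNewtonTauWeakHexagonPlanar
import Summits.ValiantsHypothesis.ValiantsHypothesis.Theorems.NewtonUnitEquationsNewtonTauWeakHexagonTrichotomy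
import Summits.ValiantsHypothesis.ValiantsHypothesis.Theorems.NewtonUnitEquationsNewtonTauWeakHexagonDichotomy
import Summits.ValiantsHypothesis.ValiantsHypothesis.Theorems.NewtonUnitEquationsNewtonTauWeakHexagonChartCountRoots
import Summits.ValiantsHypothesis.ValiantsHypothesis.Theorems.NewtonUnitEquationsNewtonTauWeakHexagonUnion
import Summits.ValiantsHypothesis.ValiantsHypothesis.Theorems.NewtonUnitEquationsNewtonTauWeakHexagonMinorStructure
import Summits.ValiantsHypothesis.ValiantsHypothesis.Theorems.NewtonUnitEquationsNewtonTauWeakHexagonAllK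

/-!
# `NewtonUnitEquationsNewtonTauWeakHexagonClasses` — the class theorem (three rays, `q` diagonal classes)

Rung toward `stub_binomialNewtonTauCommon` (T2 = KPTT Conj. 1 at `t = 2`; crux `NewtonTauWeak`,
stmt-ValiantsHypothesis-5904), line `binomial-normal-form`, lead c4 (K-UNIFORM three-ray regime): registered stub
`stub_hexClasses`.

`stub_hexClasses`: for x-only `X_i`, y-only `Y_i` (`i < k`), diagonal `D_l` (`l < q`) and a class map
`cls : Fin k → Fin q`, `vert(Σ_i X_i·Y_i·D_{cls i}) ≤ 4 + 4q(q+1)(8 + 8·q!·2^{q·q}·k^q)` — POLYNOMIAL in the number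
`k` of products for every fixed number `q` of diagonal classes.  Proof = the homogeneous Wronskian route of
`hex_vert_sum_hexagon_le_allK` (`…HexagonAllK`) run over the `q` CLASSES: regroup
`F = Σ_{l<q} M_l·D_l` with the class sums `M_l = Σ_i [cls i = l] X_i·Y_i`, separated of rank `≤ k`; the Wronskian
minors of `g_l = M_l·D_l` are (diagonal) × (separated of rank `≤ s!·2^{Σ rows}·k^s ≤ q!·2^{q·q}·k^q`)
(`hex_structure_minor_sep`, the rank-`k` version of `hex_structure_minor`), and the dichotomy
(`hex_key_dichotomy`) / root-form chart count (`hex_chart_count_roots`, `hex_ncard_chartTops_iUnion_le`,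
`stub_vertexCharts`) go through verbatim. [folklore: Wronskian method with the direction-killing derivation]
-/

set_option linter.dupNamespace false

noncomputable section

namespace Summit.ValiantsHypothesis.ValiantsHypothesis.Theorems.NewtonUnitEquationsNewtonTauWeak

open scoped BigOperators
open MvPolynomial
open Literature.Computability.AlgebraicComplexity (newtonVertexCount)
open Summit.ValiantsHypothesis.ValiantsHypothesis.Theorems.NewtonTauWeakVdp
open Summit.ValiantsHypothesis.ValiantsHypothesis.Theorems.NewtonTauWeak.Negative (vert)

/-- **Structure of the Wronskian minors of (separated of rank `k`) × (diagonal) columns.** For columns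
`g_b = M_b·D_b` (`b < s`) with `M_b = Σ_{c<k} P_{bc}·Q_{bc}` separated of rank `k` (`P` x-only, `Q` y-only) and `D_b`
diagonal, and row orders `rows : Fin s → ℕ`, the determinant `det[Δ^{rows a} g_b]` is `(Π_b D_b) · m` with `m`
separated of rank `≤ s!·2^{Σ_a rows a}·k^s` (the rank-`k` version of `hex_structure_minor`: `Δ` kills `D_b`,
`Δ^n M_b` is separated of rank `≤ 2^n·k` by `hex_sep_delta`, and `det = Σ_σ sign σ Π_a (…)` multiplies/adds ranks).
[folklore] -/
theorem hex_structure_minor_sep (Δ : MvPolynomial (Fin 2) ℂ → MvPolynomial (Fin 2) ℂ)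
    (hΔ : ∀ p e, coeff e (Δ p) = (((e 0 : ℕ) : ℂ) - ((e 1 : ℕ) : ℂ)) * coeff e p)
    (hL : ∀ p q, Δ (p * q) = Δ p * q + p * Δ q)
    {s k : ℕ} (P Q : Fin s → Fin k → MvPolynomial (Fin 2) ℂ) (D : Fin s → MvPolynomial (Fin 2) ℂ)
    (hP : ∀ b c, ∀ e ∈ (P b c).support, e 1 = 0) (hQ : ∀ b c, ∀ e ∈ (Q b c).support, e 0 = 0)
    (hD : ∀ b, ∀ e ∈ (D b).support, e 0 = e 1) (rows : Fin s → ℕ) :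
    ∃ m : MvPolynomial (Fin 2) ℂ,
      (∃ R : ℕ, R ≤ Nat.factorial s * 2 ^ (∑ a, rows a) * k ^ s ∧
        ∃ P' Q' : Fin R → MvPolynomial (Fin 2) ℂ, (∀ r, ∀ e ∈ (P' r).support, e 1 = 0) ∧
          (∀ r, ∀ e ∈ (Q' r).support, e 0 = 0) ∧ m = ∑ r, P' r * Q' r) ∧
      (Matrix.of fun a b : Fin s => (Δ^[rows a]) ((∑ c, P b c * Q b c) * D b)).det =
        (∏ b, D b) * m := by
  -- adapted from `hex_structure_minor` (…HexagonMinorStructure.lean): rank-`k` columns instead of rank `1`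
  -- Step 1: `Δ` kills the diagonal factor, so it commutes past `D b` by Leibniz.
  have hD0 : ∀ b, Δ (D b) = 0 := fun b => hex_delta_eq_zero_of_diag Δ hΔ (D b) (hD b)
  have hiter : ∀ b n, Δ^[n] ((∑ c, P b c * Q b c) * D b) = Δ^[n] (∑ c, P b c * Q b c) * D b := by
    intro b n
    induction n with
    | zero => rfl
    | succ n ih =>
      rw [Function.iterate_succ_apply', ih, hL, hD0, mul_zero, add_zero,
        Function.iterate_succ_apply']
  -- Step 2: `Δ^[n] M_b` is separated of rank `≤ 2 ^ n * k`.
  have hsep : ∀ b n, ∃ R : ℕ, R ≤ 2 ^ n * k ∧ ∃ P' Q' : Fin R → MvPolynomial (Fin 2) ℂ,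
      (∀ r, ∀ e ∈ (P' r).support, e 1 = 0) ∧ (∀ r, ∀ e ∈ (Q' r).support, e 0 = 0) ∧
        Δ^[n] (∑ c, P b c * Q b c) = ∑ r, P' r * Q' r := by
    intro b n
    induction n with
    | zero => exact ⟨k, by rw [pow_zero, one_mul], P b, Q b, hP b, hQ b, rfl⟩
    | succ n ih =>
      obtain ⟨R, hR, hm⟩ := ih
      refine ⟨2 * R, ?_, ?_⟩
      · rw [pow_succ', mul_assoc]
        exact Nat.mul_le_mul_left 2 hR
      · rw [Function.iterate_succ_apply']
        exact hex_sep_delta Δ hΔ hL hm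
  -- Step 3: expand the determinant over permutations.
  refine ⟨∑ σ : Equiv.Perm (Fin s), ((Equiv.Perm.sign σ : ℤ) : MvPolynomial (Fin 2) ℂ) *
      ∏ a, Δ^[rows (σ a)] (∑ c, P a c * Q a c), ?_, ?_⟩
  · -- each signed product is separated of rank `≤ 2 ^ (∑ a, rows a) * k ^ s`
    have key : ∀ σ : Equiv.Perm (Fin s), ∃ R : ℕ, R ≤ 2 ^ (∑ a, rows a) * k ^ s ∧
        ∃ P' Q' : Fin R → MvPolynomial (Fin 2) ℂ, (∀ r, ∀ e ∈ (P' r).support, e 1 = 0) ∧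
          (∀ r, ∀ e ∈ (Q' r).support, e 0 = 0) ∧
          ((Equiv.Perm.sign σ : ℤ) : MvPolynomial (Fin 2) ℂ) *
              ∏ a, Δ^[rows (σ a)] (∑ c, P a c * Q a c) = ∑ r, P' r * Q' r := by
      intro σ
      have h1 : ∀ e ∈ (1 : MvPolynomial (Fin 2) ℂ).support, e = 0 := fun e he => by
        rw [support_one] at he
        exact Finset.mem_singleton.1 he
      have hprod : ∃ R : ℕ, R ≤ ∏ a, (2 ^ (rows (σ a)) * k) ∧
          ∃ P' Q' : Fin R → MvPolynomial (Fin 2) ℂ, (∀ r, ∀ e ∈ (P' r).support, e 1 = 0) ∧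
            (∀ r, ∀ e ∈ (Q' r).support, e 0 = 0) ∧
            ∏ a, Δ^[rows (σ a)] (∑ c, P a c * Q a c) = ∑ r, P' r * Q' r := by
        refine Finset.prod_hom_rel (r := fun B m => ∃ R : ℕ, R ≤ B ∧
            ∃ P' Q' : Fin R → MvPolynomial (Fin 2) ℂ, (∀ r, ∀ e ∈ (P' r).support, e 1 = 0) ∧
              (∀ r, ∀ e ∈ (Q' r).support, e 0 = 0) ∧ m = ∑ r, P' r * Q' r)
          (f := fun a => 2 ^ (rows (σ a)) * k)
          (g := fun a => Δ^[rows (σ a)] (∑ c, P a c * Q a c)) ?_ ?_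
        · exact ⟨1, le_rfl, fun _ => 1, fun _ => 1, fun _ e he => by rw [h1 e he]; rfl,
            fun _ e he => by rw [h1 e he]; rfl, by simp⟩
        · rintro a B m ⟨R, hR, hm⟩
          obtain ⟨R', hR', hm'⟩ := hsep a (rows (σ a))
          exact ⟨R' * R, Nat.mul_le_mul hR' hR, hex_sep_mul hm' hm⟩
      rw [Finset.prod_mul_distrib, Finset.prod_pow_eq_pow_sum, Equiv.sum_comp σ rows, Finset.prod_const,
        Finset.card_univ, Fintype.card_fin] at hprod
      obtain ⟨R, hR, hm⟩ := hprod
      rcases Int.units_eq_one_or (Equiv.Perm.sign σ) with h | h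
      · rw [h, Units.val_one, Int.cast_one, one_mul]
        exact ⟨R, hR, hm⟩
      · rw [h, Units.val_neg, Units.val_one, Int.cast_neg, Int.cast_one, neg_one_mul]
        exact ⟨R, hR, hex_sep_neg hm⟩
    -- sum over the `s!` permutations: ranks add up
    have hcard : Nat.factorial s * 2 ^ (∑ a, rows a) * k ^ s =
        ∑ _σ : Equiv.Perm (Fin s), 2 ^ (∑ a, rows a) * k ^ s := by
      rw [Finset.sum_const, Finset.card_univ, Fintype.card_perm, Fintype.card_fin, smul_eq_mul, mul_assoc]
    rw [hcard]
    refine Finset.sum_hom_rel (r := fun B m => ∃ R : ℕ, R ≤ B ∧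
        ∃ P' Q' : Fin R → MvPolynomial (Fin 2) ℂ, (∀ r, ∀ e ∈ (P' r).support, e 1 = 0) ∧
          (∀ r, ∀ e ∈ (Q' r).support, e 0 = 0) ∧ m = ∑ r, P' r * Q' r)
      (f := fun _ => 2 ^ (∑ a, rows a) * k ^ s)
      (g := fun σ => ((Equiv.Perm.sign σ : ℤ) : MvPolynomial (Fin 2) ℂ) *
        ∏ a, Δ^[rows (σ a)] (∑ c, P a c * Q a c)) ?_ ?_
    · exact ⟨0, le_rfl, Fin.elim0, Fin.elim0, fun r => r.elim0, fun r => r.elim0, by simp⟩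
    · rintro σ B m ⟨R, hR, hm⟩
      obtain ⟨R', hR', hm'⟩ := key σ
      exact ⟨R' + R, Nat.add_le_add hR' hR, hex_sep_add hm' hm⟩
  · rw [Matrix.det_apply', Finset.mul_sum]
    refine Finset.sum_congr rfl fun σ _ => ?_
    simp only [Matrix.of_apply, hiter]
    rw [Finset.prod_mul_distrib]
    ring

open HexagonAllK

/-- **The class theorem (three rays, `q` diagonal classes).** For x-only `X_i`, y-only `Y_i` (`i < k`), diagonal
`D_l` (`l < q`) and a class map `cls : Fin k → Fin q`,
`vert(Σ_i X_i·Y_i·D_{cls i}) ≤ 4 + 4q(q+1)(8 + 8·q!·2^{q·q}·k^q)`: the homogeneous `Δ`-Wronskian of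
`hex_vert_sum_hexagon_le_allK` run over the `q` CLASSES `g_l = M_l·D_l`, `M_l = Σ_{cls i = l} X_i·Y_i` separated of
rank `≤ k` (`HexagonAllK.exists_homogeneous_equation`, minors via `hex_structure_minor_sep`, dichotomy
`hex_key_dichotomy`, root-form chart count `hex_chart_count_roots`). Polynomial in `k` for every fixed `q`.
[folklore: Wronskian method] -/
theorem stub_hexClasses (k q : ℕ) (cls : Fin k → Fin q)
    (X Y : Fin k → MvPolynomial (Fin 2) ℂ) (D : Fin q → MvPolynomial (Fin 2) ℂ)
    (hX : ∀ i, ∀ e ∈ (X i).support, e 1 = 0) (hY : ∀ i, ∀ e ∈ (Y i).support, e 0 = 0)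
    (hD : ∀ l, ∀ e ∈ (D l).support, e 0 = e 1) :
    vert (∑ i, X i * Y i * D (cls i)) ≤
      4 + 4 * q * (q + 1) * (8 + 8 * (Nat.factorial q * 2 ^ (q * q) * k ^ q)) := by
  -- adapted from `hex_vert_sum_hexagon_le_allK` (…HexagonAllK.lean): classes instead of products
  classical
  obtain ⟨Δ, hΔ⟩ := hex_exists_delta
  have hL := hex_delta_mul Δ hΔ
  change newtonVertexCount (∑ i, X i * Y i * D (cls i)) ≤ _
  -- `k = 0`: the sum is empty
  rcases Nat.eq_zero_or_pos k with hk | hk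
  · subst hk
    rw [Fin.sum_univ_zero, newtonVertexCount_zero]
    exact Nat.zero_le _
  -- the class sums `M_l = Σ_i [cls i = l] X_i · Y_i`, separated of rank `≤ k`
  set Xc : Fin q → Fin k → MvPolynomial (Fin 2) ℂ := fun l i => if cls i = l then X i else 0 with hXc
  have hXc_pos : ∀ l i, cls i = l → Xc l i = X i := fun l i h => if_pos h
  have hXc_neg : ∀ l i, cls i ≠ l → Xc l i = 0 := fun l i h => if_neg h
  have hXc' : ∀ l i, ∀ e ∈ (Xc l i).support, e 1 = 0 := by
    intro l i e he
    by_cases h : cls i = l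
    · rw [hXc_pos l i h] at he
      exact hX i e he
    · rw [hXc_neg l i h, support_zero] at he
      exact absurd he (Finset.notMem_empty e)
  set g : Fin q → MvPolynomial (Fin 2) ℂ := fun l => (∑ i, Xc l i * Y i) * D l with hg
  have hFg : (∑ i, X i * Y i * D (cls i)) = ∑ l, g l := by
    have h1 : ∀ i, X i * Y i * D (cls i) = ∑ l, Xc l i * Y i * D l := by
      intro i
      rw [Finset.sum_eq_single (cls i)]
      · rw [hXc_pos (cls i) i rfl]
      · intro l _ hl
        rw [hXc_neg l i (Ne.symm hl), zero_mul, zero_mul]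
      · intro h; exact absurd (Finset.mem_univ _) h
    calc (∑ i, X i * Y i * D (cls i)) = ∑ i, ∑ l, Xc l i * Y i * D l :=
          Finset.sum_congr rfl fun i _ => h1 i
      _ = ∑ l, ∑ i, Xc l i * Y i * D l := Finset.sum_comm
      _ = ∑ l, g l := Finset.sum_congr rfl fun l _ => (Finset.sum_mul _ _ _).symm
  rw [hFg]
  set F := ∑ l, g l with hF
  obtain ⟨s, e, hsK, he, hdet, hid⟩ := exists_homogeneous_equation Δ hΔ g
  set N : Fin (s + 1) → MvPolynomial (Fin 2) ℂ := fun i =>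
    (Matrix.of fun a b : Fin s => (Δ^[((Fin.succAbove i a : Fin (s + 1)) : ℕ)]) (g (e b))).det with hN
  have hid' : ∑ i : Fin (s + 1), (-1 : MvPolynomial (Fin 2) ℂ) ^ (i : ℕ) * (N i * (Δ^[(i : ℕ)]) F) = 0 := hid
  -- the common bound on the vertex counts of the minors
  set B : ℕ := Nat.factorial q * 2 ^ (q * q) * k ^ q with hB
  have hVN : ∀ i, newtonVertexCount (N i) ≤ 8 + 8 * B := by
    intro i
    obtain ⟨m, ⟨R, hR, Pm, Qm, hPm, hQm, hm⟩, hEq⟩ := hex_structure_minor_sep Δ hΔ hL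
      (fun b c => Xc (e b) c) (fun _ c => Y c) (fun b => D (e b))
      (fun b c => hXc' (e b) c) (fun _ c => hY c) (fun b => hD (e b))
      (fun a => ((Fin.succAbove i a : Fin (s + 1)) : ℕ))
    have hdiag : ∀ v ∈ (∏ b, D (e b)).support, v 0 = v 1 :=
      diag_prod Finset.univ (fun b => D (e b)) fun b _ => hD (e b)
    have h := hex_vert_diag_mul_le (∏ b, D (e b)) m hdiag ⟨Pm, Qm, hPm, hQm, hm⟩
    have hNi : N i = (∏ b, D (e b)) * m := hEq
    rw [hNi]
    refine h.trans ?_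
    have hR' : R ≤ B := by
      refine hR.trans ?_
      have h1 : Nat.factorial s ≤ Nat.factorial q := Nat.factorial_le hsK
      have h2 : 2 ^ (∑ a : Fin s, ((Fin.succAbove i a : Fin (s + 1)) : ℕ)) ≤ 2 ^ (q * q) := by
        apply Nat.pow_le_pow_right (by norm_num)
        calc ∑ a : Fin s, ((Fin.succAbove i a : Fin (s + 1)) : ℕ) ≤ ∑ _a : Fin s, s :=
              Finset.sum_le_sum fun a _ => Nat.lt_succ_iff.mp (Fin.succAbove i a).isLt
          _ = s * s := by rw [Finset.sum_const, Finset.card_univ, Fintype.card_fin, smul_eq_mul]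
          _ ≤ q * q := Nat.mul_le_mul hsK hsK
      have h3 : k ^ s ≤ k ^ q := Nat.pow_le_pow_right hk hsK
      exact Nat.mul_le_mul (Nat.mul_le_mul h1 h2) h3
    omega
  -- the indicator of the union of the supports
  set S := (Finset.univ : Finset (Fin (s + 1))).biUnion fun i => (N i).support with hS
  set U : MvPolynomial (Fin 2) ℂ := ∑ v ∈ S, monomial v (1 : ℂ) with hU
  have hUsupp : U.support = S := hex_support_sum_monomial_one S
  have hUiff : ∀ v, v ∈ U.support ↔ ∃ i, v ∈ (N i).support := by
    intro v
    rw [hUsupp, hS, Finset.mem_biUnion]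
    simp
  have hNlast : N (Fin.last s) ≠ 0 := by
    have h : N (Fin.last s) = (Matrix.of fun a b : Fin s => (Δ^[(a : ℕ)]) (g (e b))).det := by
      simp only [hN]
      congr 1
      ext a b
      simp [Fin.succAbove_last]
    rw [h]; exact hdet
  have hU0 : U ≠ 0 := by
    intro h
    have hne : (N (Fin.last s)).support.Nonempty := by
      rw [Finset.nonempty_iff_ne_empty, Ne, support_eq_empty]; exact hNlast
    obtain ⟨v, hv⟩ := hne
    have : v ∈ U.support := (hUiff v).mpr ⟨_, hv⟩
    rw [h, support_zero] at this
    exact absurd this (Finset.notMem_empty v)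
  -- chart tops of `U`
  have hTU : ∀ σ : ℝ, {z : Fin 2 →₀ ℕ | ∃ t : ℝ, IsGeneric ![σ, t] ∧ IsTop ![σ, t] U z}.ncard ≤
      (q + 1) * (8 + 8 * B) := by
    intro σ
    refine (hex_ncard_chartTops_iUnion_le σ U N hUiff).trans ?_
    calc ∑ i, newtonVertexCount (N i) ≤ ∑ _i : Fin (s + 1), (8 + 8 * B) := Finset.sum_le_sum fun i _ => hVN i
      _ = (s + 1) * (8 + 8 * B) := by rw [Finset.sum_const, Finset.card_univ, Fintype.card_fin, smul_eq_mul]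
      _ ≤ (q + 1) * (8 + 8 * B) := Nat.mul_le_mul_right _ (by omega)
  -- the root polynomial and the dichotomy
  set Pz : (Fin 2 →₀ ℕ) → Polynomial ℂ := fun z =>
    ∑ i : Fin (s + 1), Polynomial.C ((-1 : ℂ) ^ (i : ℕ) * coeff z (N i)) * Polynomial.X ^ (i : ℕ) with hPz
  have hPz' : ∀ z ∈ U.support, Pz z ≠ 0 ∧ (Pz z).natDegree ≤ q := by
    intro z hz
    obtain ⟨hdeg, hne, -⟩ := rootPoly_props (fun i : Fin (s + 1) => (-1 : ℂ) ^ (i : ℕ) * coeff z (N i))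
    obtain ⟨i, hi⟩ := (hUiff z).mp hz
    refine ⟨hne i ?_, hdeg.trans hsK⟩
    exact mul_ne_zero (pow_ne_zero _ (neg_ne_zero.mpr one_ne_zero)) (mem_support_iff.mp hi)
  have hroot : ∀ σ : ℝ, ∀ t : ℝ, IsGeneric ![σ, t] → ∀ v z : Fin 2 →₀ ℕ, IsTop ![σ, t] F v → v 0 ≠ v 1 →
      IsTop ![σ, t] U z → (Pz z).IsRoot ((((v 0 : ℕ) : ℂ)) - ((v 1 : ℕ) : ℂ)) := by
    intro σ t ht v z hv hvv hz
    obtain ⟨-, -, heval⟩ := rootPoly_props (fun i : Fin (s + 1) => (-1 : ℂ) ^ (i : ℕ) * coeff z (N i))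
    rw [Polynomial.IsRoot.def, hPz, heval]
    have h := hex_key_dichotomy Δ hΔ N F U hid' hUiff ht hv hvv hz
    rw [← h]
  -- count
  have hchart : ∀ σ : ℝ, {v : Fin 2 →₀ ℕ | ∃ t : ℝ, IsGeneric ![σ, t] ∧ IsTop ![σ, t] F v}.ncard ≤
      2 + 2 * q * ((q + 1) * (8 + 8 * B)) := by
    intro σ
    refine (hex_chart_count_roots σ F U q Pz hPz' (hroot σ) hU0).trans ?_
    have h := hTU σ
    have : 2 * q * {z : Fin 2 →₀ ℕ | ∃ t : ℝ, IsGeneric ![σ, t] ∧ IsTop ![σ, t] U z}.ncard ≤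
        2 * q * ((q + 1) * (8 + 8 * B)) := Nat.mul_le_mul_left _ h
    omega
  have hv := stub_vertexCharts F
  have h1 := hchart 1
  have h2 := hchart (-1)
  have hKB : 2 * q * ((q + 1) * (8 + 8 * B)) = 2 * (q * (q + 1) * (8 + 8 * B)) := by ring
  rw [hKB] at h1 h2
  calc newtonVertexCount F ≤ _ := hv
    _ ≤ (2 + 2 * (q * (q + 1) * (8 + 8 * B))) + (2 + 2 * (q * (q + 1) * (8 + 8 * B))) := add_le_add h1 h2
    _ = 4 + 4 * q * (q + 1) * (8 + 8 * B) := by ring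

end Summit.ValiantsHypothesis.ValiantsHypothesis.Theorems.NewtonUnitEquationsNewtonTauWeak

end
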